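import Summits.Ventures.HSemireg.WedgeHankelSubstitutionJordanPartition

/-!
# Venture HSemireg — THE PURE CLASS `E_0` GENERATES A JORDAN BLOCK OF MAXIMAL SIZE UNDER THE SHEAR: the iterates `(SbC(shear λ) − 1)^k E_0`, `k < min(p, n+1)` (`p` = the
# characteristic exponent, `λ ≠ 0`), are linearly independent — so `E_0` is a CYCLIC VECTOR of th-7's class space exactly when `n!·λ ≠ 0`, and in characteristic `p ≤ n`
# its cyclic subspace has dimension `p`, the size of the largest block (J3)

HONEST FRAMING. Part of the Lean index of the computation cell `pub-hsemireg` (seat p10 gen 21, Sunday typer «UNIFORM-IN-n»).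
Finite-dimensional EXTERIOR ALGEBRA + linear algebra ONLY: no variety, no cohomology theory, no sheaf, no Ext group, no semiregularity map;
nothing here says that HC / HC_CM / HC_AV holds; no Literature fact is declared or used.  Custodian versions as in `WedgeHankelSiegelIdeal` (1/3) and `WedgeHankelFrameChange`;
the dictionary (`E_0` = the `n`-th power of a linear form; its translates span the binary forms of degree `n` iff `n! ≠ 0`) is QUOTED, never asserted.

WHAT IS IN THE TREE.  K1 (`WedgeHankelSubstitutionJordanPartition`, this seat): `repr_SbC_shear_sub_one_pow_spikeBasis` (the `E_{i+k}`-coordinate of `N^k E_i` is `(i+1)⋯(i+k)λ^k`,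
nothing below), `linearIndependent_of_repr_pivot` (triangular families are independent), the Jordan type `(p, …, p, n % p + 1)`; I18 `SbC_shear_sub_one_pow_self_apply_spike_zero`
(`N^n E_0 = n!λ^n E_n`), J3 `SbC_shear_sub_one_pow_char` (`N^p = 0`).  THIS FILE (namespace `Summit.Ventures.HSemireg.Wedge.HankelFrameChange` continued; imports K1) reads the
cyclic subspace of `E_0`:
* §290 `repr_pow_shear_spikeBasis_zero` (coordinates of `N^k E_0`: zero below `k`, `k!·λ^k` at `k`), **`linearIndependent_pow_shear_spikeBasis_zero`** (the iterates `N^k E_0` over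
  `k < m` are independent as soon as `(m−1)!·λ ≠ 0`... stated: over the `k : Fin m` with `m ≤ n + 1` and `((m − 1)! : K) ≠ 0`), **`span_pow_shear_spikeBasis_zero_eq_top`**
  (`n!·λ ≠ 0`: the `n + 1` iterates span the class space — `E_0` IS A CYCLIC VECTOR of the shear), `span_pow_shear_spikeBasis_zero_eq_top_charZero`.
* §291 CHARACTERISTIC `p`: **`linearIndependent_pow_shear_spikeBasis_zero_char`** (`k < min(p, n+1)`), **`finrank_span_pow_shear_spikeBasis_zero_char`: the cyclic subspace of
  `E_0` under the shear has dimension `min(p, n+1)`** — the size of the largest Jordan block (J3) is realised by the pure class; `span_pow_shear_spikeBasis_zero_ne_top_char`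
  (`p ≤ n`: `E_0` is NOT cyclic), **`span_pow_shear_spikeBasis_zero_eq_top_iff`** (`λ ≠ 0`, characteristic `p`: cyclic iff `n < p`).
NOT typed here: the cyclic subspaces of the other spikes `E_i` in characteristic `p`; cyclic vectors of general unipotent `g` (conjugate, J11); anything Ext-side.  New names only.
-/

open Module

namespace Summit.Ventures.HSemireg.Wedge.HankelFrameChange

open Summit.Ventures.HSemireg.Wedge Summit.Ventures.HSemireg.Wedge.Kunneth Summit.Ventures.HSemireg.Wedge.Hankel
  Summit.Ventures.HSemireg.Wedge.BasisFree Summit.Ventures.HSemireg.Wedge.HankelSiegel Summit.Ventures.HSemireg.Wedge.HankelSiegelIdeal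
  Summit.Ventures.HSemireg.Wedge.KunnethKernel Summit.Ventures.HSemireg.Wedge.HankelRankOne Summit.Ventures.HSemireg.Wedge.KernelDuality

variable (K : Type*) [Field K] {n : ℕ}

/-! ## §290. The iterates of the pure class under the shear -/

/-- the spike coordinates of `(SbC(shear λ) − 1)^k E_0`: zero below `k`, and `k!·λ^k` at `k` (K1 with `i = 0`; `1.ascFactorial k = k!`). -/
theorem repr_pow_shear_spikeBasis_zero (lam : K) (k : ℕ) :
    (∀ a : Fin (n + 1), (a : ℕ) < k → (spikeBasis K n).repr (((SbC K 1 lam 0 1 - 1) ^ k) (spikeBasis K n 0)) a = 0) ∧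
    (∀ a : Fin (n + 1), (a : ℕ) = k → (spikeBasis K n).repr (((SbC K 1 lam 0 1 - 1) ^ k) (spikeBasis K n 0)) a = ((k.factorial : ℕ) : K) * lam ^ k) := by
  have h := repr_SbC_shear_sub_one_pow_spikeBasis K lam (0 : Fin (n + 1)) k
  simp only [Fin.val_zero, zero_add, Nat.one_ascFactorial] at h
  exact h

/-- **the iterates `N^k E_0`, `k < m`, are linearly independent whenever `m ≤ n + 1` and `(m−1)!·λ ≠ 0`** (triangular with pivots `k!λ^k`, K1 `linearIndependent_of_repr_pivot`) —
stated with the hypothesis `∀ k < m, k! ≠ 0 in K`. -/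
theorem linearIndependent_pow_shear_spikeBasis_zero {lam : K} (hlam : lam ≠ 0) {m : ℕ} (hm : m ≤ n + 1) (hfac : ∀ k < m, ((k.factorial : ℕ) : K) ≠ 0) :
    LinearIndependent K fun k : Fin m => ((SbC K 1 lam 0 1 - 1) ^ (k : ℕ)) (spikeBasis K n 0) := by
  -- re-index by the spikes `i < m` (pivot of `N^i E_0` at `i + 0`)
  let e : Fin m → {i : Fin (n + 1) // (i : ℕ) < m} := fun k => ⟨⟨k, by omega⟩, k.2⟩
  have he : Function.Injective e := fun k k' h => Fin.ext (by simpa [e] using congrArg (fun x => ((x.1 : Fin (n + 1)) : ℕ)) h)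
  have hli : LinearIndependent K fun i : {i : Fin (n + 1) // (i : ℕ) < m} => ((SbC K 1 lam 0 1 - 1) ^ ((i : Fin (n + 1)) : ℕ)) (spikeBasis K n 0) := by
    refine linearIndependent_of_repr_pivot K (I := fun i : Fin (n + 1) => (i : ℕ) < m) _ 0 (fun i a ha => ?_) fun i => ?_
    · exact (repr_pow_shear_spikeBasis_zero K lam ((i : Fin (n + 1)) : ℕ)).1 a (by omega)
    · refine ⟨(i : Fin (n + 1)), by omega, ?_⟩
      rw [(repr_pow_shear_spikeBasis_zero K lam ((i : Fin (n + 1)) : ℕ)).2 _ rfl]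
      exact mul_ne_zero (hfac _ i.2) (pow_ne_zero _ hlam)
  exact hli.comp e he

/-- **`n!·λ ≠ 0 ⇒ E_0 IS A CYCLIC VECTOR OF THE SHEAR: the iterates `(SbC(shear λ) − 1)^k E_0`, `k ≤ n`, span th-7's class space** (`n + 1` independent vectors). -/
theorem span_pow_shear_spikeBasis_zero_eq_top (hfacn : ((n.factorial : ℕ) : K) ≠ 0) {lam : K} (hlam : lam ≠ 0) :
    Submodule.span K (Set.range fun k : Fin (n + 1) => ((SbC K 1 lam 0 1 - 1) ^ (k : ℕ)) (spikeBasis K n 0)) = ⊤ := by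
  have hli := linearIndependent_pow_shear_spikeBasis_zero K hlam le_rfl (m := n + 1) fun k hk h0 => hfacn (by
    obtain ⟨c, hc⟩ := Nat.factorial_dvd_factorial (show k ≤ n by omega)
    rw [hc, Nat.cast_mul, h0, zero_mul])
  exact hli.span_eq_top_of_card_eq_finrank' (by rw [Fintype.card_fin, finrank_eq_card_basis (spikeBasis K n), Fintype.card_fin])

/-- characteristic `0`: `E_0` is a cyclic vector of the shear for every `λ ≠ 0`. -/
theorem span_pow_shear_spikeBasis_zero_eq_top_charZero [CharZero K] {lam : K} (hlam : lam ≠ 0) :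
    Submodule.span K (Set.range fun k : Fin (n + 1) => ((SbC K 1 lam 0 1 - 1) ^ (k : ℕ)) (spikeBasis K n 0)) = ⊤ :=
  span_pow_shear_spikeBasis_zero_eq_top K (Nat.cast_ne_zero.mpr (Nat.factorial_ne_zero n)) hlam

/-! ## §291. Characteristic `p`: the cyclic subspace of `E_0` has dimension `min(p, n+1)` -/

/-- **characteristic `p`, `λ ≠ 0`: the iterates `N^k E_0`, `k < min(p, n+1)`, are linearly independent** (`k! ≠ 0` for `k < p`). -/
theorem linearIndependent_pow_shear_spikeBasis_zero_char {lam : K} (hlam : lam ≠ 0) (p : ℕ) [Fact p.Prime] [CharP K p] :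
    LinearIndependent K fun k : Fin (min p (n + 1)) => ((SbC K 1 lam 0 1 - 1) ^ (k : ℕ)) (spikeBasis K n 0) :=
  linearIndependent_pow_shear_spikeBasis_zero K hlam (min_le_right p (n + 1)) fun _ hk => factorial_cast_ne_zero_of_lt_char K p (lt_of_lt_of_le hk (min_le_left p (n + 1)))

/-- the cyclic subspace of `E_0` is spanned by the first `min(p, n+1)` iterates (the later ones vanish: `N^k = 0` for `k ≥ min(p, n+1)`, J3). -/
theorem span_pow_shear_spikeBasis_zero_eq_span_min {lam : K} (hlam : lam ≠ 0) (p : ℕ) [Fact p.Prime] [CharP K p] :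
    Submodule.span K (Set.range fun k : ℕ => ((SbC K 1 lam 0 1 - 1) ^ k) (spikeBasis K n 0)) =
      Submodule.span K (Set.range fun k : Fin (min p (n + 1)) => ((SbC K 1 lam 0 1 - 1) ^ (k : ℕ)) (spikeBasis K n 0)) := by
  apply le_antisymm
  · rw [Submodule.span_le]
    rintro _ ⟨k, rfl⟩
    by_cases hk : k < min p (n + 1)
    · exact Submodule.subset_span ⟨⟨k, hk⟩, rfl⟩
    · have h0 : ((SbC K 1 lam 0 1 (n := n) - 1) ^ k) (spikeBasis K n 0) = 0 := by
        rw [(SbC_shear_sub_one_pow_eq_zero_iff_char K hlam p k).mpr (not_lt.mp hk), LinearMap.zero_apply]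
      simp only [h0]
      exact Submodule.zero_mem _
  · rw [Submodule.span_le]
    rintro _ ⟨k, rfl⟩
    exact Submodule.subset_span ⟨(k : ℕ), rfl⟩

/-- **CHARACTERISTIC `p`, `λ ≠ 0`: THE CYCLIC SUBSPACE OF `E_0` UNDER THE SHEAR HAS DIMENSION `min(p, n+1)`** — the pure class generates a Jordan block of the largest size (J3). -/
theorem finrank_span_pow_shear_spikeBasis_zero_char {lam : K} (hlam : lam ≠ 0) (p : ℕ) [Fact p.Prime] [CharP K p] :
    finrank K ↥(Submodule.span K (Set.range fun k : ℕ => ((SbC K 1 lam 0 1 (n := n) - 1) ^ k) (spikeBasis K n 0))) = min p (n + 1) := by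
  rw [span_pow_shear_spikeBasis_zero_eq_span_min K hlam p, finrank_span_eq_card (linearIndependent_pow_shear_spikeBasis_zero_char K hlam p), Fintype.card_fin]

/-- **`p ≤ n`: `E_0` is NOT a cyclic vector of the shear in characteristic `p`** (its cyclic subspace has dimension `p < n + 1`). -/
theorem span_pow_shear_spikeBasis_zero_ne_top_char {lam : K} (hlam : lam ≠ 0) (p : ℕ) [Fact p.Prime] [CharP K p] (hpn : p ≤ n) :
    Submodule.span K (Set.range fun k : ℕ => ((SbC K 1 lam 0 1 (n := n) - 1) ^ k) (spikeBasis K n 0)) ≠ ⊤ := by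
  intro h
  have hd := finrank_span_pow_shear_spikeBasis_zero_char K hlam p (n := n)
  rw [h, finrank_top, finrank_eq_card_basis (spikeBasis K n), Fintype.card_fin, min_eq_left (by omega : p ≤ n + 1)] at hd
  omega

/-- **characteristic `p`, `λ ≠ 0`: `E_0` is a cyclic vector of the shear on th-7's classes of degree `n` IFF `n < p`.** -/
theorem span_pow_shear_spikeBasis_zero_eq_top_iff {lam : K} (hlam : lam ≠ 0) (p : ℕ) [Fact p.Prime] [CharP K p] :
    Submodule.span K (Set.range fun k : ℕ => ((SbC K 1 lam 0 1 (n := n) - 1) ^ k) (spikeBasis K n 0)) = ⊤ ↔ n < p := by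
  constructor
  · intro h
    by_contra hnp
    exact span_pow_shear_spikeBasis_zero_ne_top_char K hlam p (not_lt.mp hnp) h
  · intro h
    apply Submodule.eq_top_of_finrank_eq
    rw [finrank_span_pow_shear_spikeBasis_zero_char K hlam p, min_eq_right (by omega : n + 1 ≤ p), finrank_eq_card_basis (spikeBasis K n), Fintype.card_fin]

end Summit.Ventures.HSemireg.Wedge.HankelFrameChange
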